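import Mathlib.LinearAlgebra.Determinant
import Mathlib.LinearAlgebra.Dual.Lemmas
import Mathlib.LinearAlgebra.BilinearForm.Properties
import Mathlib.LinearAlgebra.Eigenspace.Basic
import Mathlib.LinearAlgebra.FiniteDimensional.Lemmas
import HarnessLib

/-!
# Weil-type ladder — linear algebra for THEOREM EXC (iii) in every rank (determinants on invariant subspaces)

b2b cell `hweil` (packet `run/shared/lean/b2b/hodge-weil/`), prover 3, report `b2b-hweil-pv3-g48/TWIST-LEFSCHETZ.md` §2.
Field-level lemmas (no topology, no abelian varieties) used by `Theorems/WeilTypeLadderTwistLefschetzClasses`: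

* `det_restrict_mul_det_restrict_eq_one_of_pairing` — if an endomorphism `u` preserves two subspaces `V₁`, `V₂`
  and a bilinear pairing `P` that is PERFECT between `V₁` and `V₂`, then `det(u|V₁) · det(u|V₂) = 1`
  (`u|V₂` is the `P`-transpose-inverse of `u|V₁`; `det` of a dual map is `det`).
* `det_restrict_sup_eq_mul` — for DISJOINT invariant subspaces, `det(u|V₁ ⊔ V₂) = det(u|V₁) · det(u|V₂)`.
* `alternatingMap_apply_comp_eq_det_smul`, `alternatingMap_apply_restrict_eq_det_smul` — a top-degree alternating map
  transforms under an endomorphism by its determinant (on a subspace: by the determinant of the restriction).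
* `form_eq_zero_of_eigenvalues`, `eq_zero_of_form_eigenspace_eq_zero` — for a non-degenerate form invariant under a
  diagonalisable `T`, the eigenspaces `V_c`, `V_{c'}` are orthogonal unless `c c' = 1`, and `V_c × V_{c⁻¹}` is perfect.

All [folklore] linear algebra (Lang, *Algebra*, XIII §4, XIV §2; Bourbaki, *Algèbre* IX §1).
-/

-- every declaration of this problem lives in `Summit.HodgeConjecture.HodgeConjecture.…` (summit = sub-problem)
set_option linter.dupNamespace false

namespace Summit.HodgeConjecture.HodgeConjecture.WeilTypeLadder

section Determinants

variable {K V : Type*} [Field K] [AddCommGroup V] [Module K V] [FiniteDimensional K V]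

/-- **Perfect pairings invert determinants.** Let `u : V → V` preserve the subspaces `V₁`, `V₂` and the bilinear
pairing `P` on `V₁ × V₂` (`P (u x) (u y) = P x y`), and let `P` be perfect between `V₁` and `V₂` (no non-zero
`x ∈ V₁` pairs to zero with all of `V₂`, and conversely). Then `det(u|V₁) · det(u|V₂) = 1`. [folklore] -/
theorem det_restrict_mul_det_restrict_eq_one_of_pairing (V₁ V₂ : Submodule K V) (P : V →ₗ[K] V →ₗ[K] K)
    (u : V →ₗ[K] V) (h₁ : ∀ x ∈ V₁, u x ∈ V₁) (h₂ : ∀ y ∈ V₂, u y ∈ V₂)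
    (hleft : ∀ x ∈ V₁, (∀ y ∈ V₂, P x y = 0) → x = 0)
    (hright : ∀ y ∈ V₂, (∀ x ∈ V₁, P x y = 0) → y = 0)
    (hinv : ∀ x ∈ V₁, ∀ y ∈ V₂, P (u x) (u y) = P x y) :
    LinearMap.det (u.restrict h₁) * LinearMap.det (u.restrict h₂) = 1 := by
  classical
  -- `Φ : V₂ → Dual V₁`, `Ψ : V₁ → Dual V₂`, both injective, hence `Φ` bijective
  let Φ : V₂ →ₗ[K] Module.Dual K V₁ :=
    { toFun := fun y => (P.flip (y : V)).comp V₁.subtype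
      map_add' := fun y y' => by ext x; simp
      map_smul' := fun a y => by ext x; simp }
  have hΦ : ∀ (y : V₂) (x : V₁), Φ y x = P (x : V) (y : V) := fun y x => rfl
  let Ψ : V₁ →ₗ[K] Module.Dual K V₂ :=
    { toFun := fun x => (P (x : V)).comp V₂.subtype
      map_add' := fun x x' => by ext y; simp
      map_smul' := fun a x => by ext y; simp }
  have hΨ : ∀ (x : V₁) (y : V₂), Ψ x y = P (x : V) (y : V) := fun x y => rfl
  have hΦinj : Function.Injective Φ := by
    intro y y' hyy
    rw [← sub_eq_zero]
    have h0 : ((y - y' : V₂) : V) = 0 := by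
      refine hright _ (y - y').2 fun x hx => ?_
      have e := congrArg (fun f : Module.Dual K V₁ => f ⟨x, hx⟩) hyy
      simp only [hΦ] at e
      rw [Submodule.coe_sub, map_sub, e, sub_self]
    exact_mod_cast h0
  have hΨinj : Function.Injective Ψ := by
    intro x x' hxx
    rw [← sub_eq_zero]
    have h0 : ((x - x' : V₁) : V) = 0 := by
      refine hleft _ (x - x').2 fun y hy => ?_
      have e := congrArg (fun f : Module.Dual K V₂ => f ⟨y, hy⟩) hxx
      simp only [hΨ] at e
      rw [Submodule.coe_sub, map_sub, LinearMap.sub_apply, e, sub_self]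
    exact_mod_cast h0
  have hdim : Module.finrank K V₂ = Module.finrank K (Module.Dual K V₁) := by
    apply le_antisymm
    · exact LinearMap.finrank_le_finrank_of_injective hΦinj
    · rw [Subspace.dual_finrank_eq]
      have h := LinearMap.finrank_le_finrank_of_injective hΨinj
      rwa [Subspace.dual_finrank_eq] at h
  have hΦbij : Function.Bijective Φ :=
    ⟨hΦinj, (LinearMap.injective_iff_surjective_of_finrank_eq_finrank hdim).1 hΦinj⟩
  let Φe : V₂ ≃ₗ[K] Module.Dual K V₁ := LinearEquiv.ofBijective Φ hΦbij
  have hΦe : ∀ y : V₂, Φe y = Φ y := fun y => rfl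
  set f : V₁ →ₗ[K] V₁ := u.restrict h₁ with hf
  set g : V₂ →ₗ[K] V₂ := u.restrict h₂ with hg
  -- the invariance: `f^∨ (Φ (g y)) = Φ y`
  have hrel : ∀ y : V₂, f.dualMap (Φ (g y)) = Φ y := by
    intro y
    ext x
    rw [LinearMap.dualMap_apply, hΦ, hΦ]
    change P (u (x : V)) (u (y : V)) = P (x : V) (y : V)
    exact hinv _ x.2 _ y.2
  -- transport `g` to `Dual V₁`: `g' = Φe ∘ g ∘ Φe⁻¹`, and `f^∨ ∘ g' = id`
  have hcomp : f.dualMap ∘ₗ ((Φe : V₂ →ₗ[K] Module.Dual K V₁) ∘ₗ g ∘ₗ (Φe.symm : Module.Dual K V₁ →ₗ[K] V₂)) =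
      LinearMap.id := by
    apply LinearMap.ext
    intro φ
    simp only [LinearMap.comp_apply, LinearEquiv.coe_coe, LinearMap.id_apply]
    rw [hΦe, hrel, ← hΦe, LinearEquiv.apply_symm_apply]
  have hdet := congrArg LinearMap.det hcomp
  rw [LinearMap.det_comp, LinearMap.det_id, LinearMap.det_dualMap, LinearMap.det_conj] at hdet
  exact hdet

omit [FiniteDimensional K V] in
/-- An endomorphism preserving `V₁` and `V₂` preserves `V₁ ⊔ V₂`. [folklore] -/
theorem mapsTo_sup_of_mapsTo {V₁ V₂ : Submodule K V} {u : V →ₗ[K] V} (h₁ : ∀ x ∈ V₁, u x ∈ V₁)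
    (h₂ : ∀ y ∈ V₂, u y ∈ V₂) : ∀ z ∈ V₁ ⊔ V₂, u z ∈ V₁ ⊔ V₂ := by
  intro z hz
  obtain ⟨x, hx, y, hy, rfl⟩ := Submodule.mem_sup.1 hz
  rw [map_add]
  exact Submodule.add_mem _ (Submodule.mem_sup_left (h₁ x hx)) (Submodule.mem_sup_right (h₂ y hy))

/-- **Block determinant on disjoint invariant subspaces**: `det(u|V₁ ⊔ V₂) = det(u|V₁) · det(u|V₂)` when
`V₁ ⊓ V₂ = 0` and `u` preserves both. [folklore] -/
theorem det_restrict_sup_eq_mul (V₁ V₂ : Submodule K V) (hdis : Disjoint V₁ V₂) (u : V →ₗ[K] V)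
    (h₁ : ∀ x ∈ V₁, u x ∈ V₁) (h₂ : ∀ y ∈ V₂, u y ∈ V₂) :
    LinearMap.det (u.restrict (mapsTo_sup_of_mapsTo h₁ h₂)) =
      LinearMap.det (u.restrict h₁) * LinearMap.det (u.restrict h₂) := by
  classical
  -- the sum map `V₁ × V₂ → V₁ ⊔ V₂`, bijective since `V₁ ⊓ V₂ = 0`
  let σ : (V₁ × V₂) →ₗ[K] ↥(V₁ ⊔ V₂) :=
    LinearMap.codRestrict (V₁ ⊔ V₂)
      ((V₁.subtype.comp (LinearMap.fst K V₁ V₂)) + (V₂.subtype.comp (LinearMap.snd K V₁ V₂)))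
      fun p => Submodule.add_mem _ (Submodule.mem_sup_left p.1.2) (Submodule.mem_sup_right p.2.2)
  have hσ : ∀ p : V₁ × V₂, ((σ p : ↥(V₁ ⊔ V₂)) : V) = (p.1 : V) + (p.2 : V) := fun p => rfl
  have hσbij : Function.Bijective σ := by
    constructor
    · intro p q hpq
      have e : ((σ p : ↥(V₁ ⊔ V₂)) : V) = ((σ q : ↥(V₁ ⊔ V₂)) : V) := by rw [hpq]
      rw [hσ, hσ] at e
      have e1 : (p.1 : V) - (q.1 : V) = (q.2 : V) - (p.2 : V) := by
        rw [sub_eq_sub_iff_add_eq_add, e, add_comm]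
      have hm1 : (p.1 : V) - (q.1 : V) ∈ V₁ := V₁.sub_mem p.1.2 q.1.2
      have hm2 : (p.1 : V) - (q.1 : V) ∈ V₂ := by rw [e1]; exact V₂.sub_mem q.2.2 p.2.2
      have h0 : (p.1 : V) - (q.1 : V) = 0 := by
        have hmem : (p.1 : V) - (q.1 : V) ∈ V₁ ⊓ V₂ := Submodule.mem_inf.2 ⟨hm1, hm2⟩
        rw [hdis.eq_bot] at hmem
        exact (Submodule.mem_bot K).1 hmem
      have e2 : (p.2 : V) = (q.2 : V) := by
        rw [h0] at e1
        exact (sub_eq_zero.1 e1.symm).symm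
      exact Prod.ext (Subtype.ext (sub_eq_zero.1 h0)) (Subtype.ext e2)
    · rintro ⟨z, hz⟩
      obtain ⟨x, hx, y, hy, rfl⟩ := Submodule.mem_sup.1 hz
      exact ⟨(⟨x, hx⟩, ⟨y, hy⟩), rfl⟩
  let e : (V₁ × V₂) ≃ₗ[K] ↥(V₁ ⊔ V₂) := LinearEquiv.ofBijective σ hσbij
  have he : ∀ p : V₁ × V₂, ((e p : ↥(V₁ ⊔ V₂)) : V) = (p.1 : V) + (p.2 : V) := fun p => rfl
  have hconj : u.restrict (mapsTo_sup_of_mapsTo h₁ h₂) =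
      (e : (V₁ × V₂) →ₗ[K] ↥(V₁ ⊔ V₂)) ∘ₗ ((u.restrict h₁).prodMap (u.restrict h₂)) ∘ₗ
        (e.symm : ↥(V₁ ⊔ V₂) →ₗ[K] (V₁ × V₂)) := by
    apply LinearMap.ext
    intro z
    apply Subtype.ext
    obtain ⟨p, rfl⟩ : ∃ p : V₁ × V₂, e p = z := e.surjective z
    simp only [LinearMap.comp_apply, LinearEquiv.coe_coe, LinearEquiv.symm_apply_apply, LinearMap.prodMap_apply]
    rw [LinearMap.coe_restrict_apply, he, he, LinearMap.coe_restrict_apply, LinearMap.coe_restrict_apply, map_add]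
  rw [hconj, LinearMap.det_conj, LinearMap.det_prodMap]

end Determinants

section Alternating

variable {K V N ι : Type*} [Field K] [AddCommGroup V] [Module K V] [AddCommGroup N] [Module K N]
  [Fintype ι] [DecidableEq ι]

/-- An alternating map in as many arguments as a basis has vectors takes the value `det_b(v) • f(b)` at every
family `v` (vector-valued form of Mathlib's `AlternatingMap.eq_smul_basis_det`). [folklore] -/
theorem alternatingMap_apply_eq_basis_det_smul (f : V [⋀^ι]→ₗ[K] N) (b : Module.Basis ι K V) (v : ι → V) :
    f v = b.det v • f b := by
  rw [← sub_eq_zero, ← Module.forall_dual_apply_eq_zero_iff K]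
  intro lam
  have h := congrFun (congrArg DFunLike.coe ((lam.compAlternatingMap f).eq_smul_basis_det b)) v
  simp only [LinearMap.compAlternatingMap_apply, AlternatingMap.smul_apply, smul_eq_mul] at h
  rw [map_sub, map_smul, h, smul_eq_mul, mul_comm, sub_self]

/-- Transforming the arguments of a top-degree alternating map by an endomorphism `r` multiplies the value by
`det r`. [folklore] -/
theorem alternatingMap_apply_comp_eq_det_smul (f : V [⋀^ι]→ₗ[K] N) (b : Module.Basis ι K V) (r : V →ₗ[K] V)
    (v : ι → V) : f (fun i => r (v i)) = LinearMap.det r • f v := by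
  rw [alternatingMap_apply_eq_basis_det_smul f b (fun i => r (v i)), alternatingMap_apply_eq_basis_det_smul f b v,
    smul_smul, show (fun i => r (v i)) = ⇑r ∘ v from rfl, Module.Basis.det_comp]

/-- **On an invariant subspace**: for an alternating map `F` on the ambient space, a basis `w` of a subspace `W`
preserved by `u`, `F (u ∘ w) = det(u|W) • F w`. [folklore] -/
theorem alternatingMap_apply_restrict_eq_det_smul {W : Submodule K V} (F : V [⋀^ι]→ₗ[K] N)
    (w : Module.Basis ι K W) (u : V →ₗ[K] V) (hW : ∀ x ∈ W, u x ∈ W) :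
    F (fun i => u (w i : V)) = LinearMap.det (u.restrict hW) • F (fun i => (w i : V)) := by
  let f : W [⋀^ι]→ₗ[K] N := F.compLinearMap W.subtype
  have hf : ∀ x : ι → W, f x = F (fun i => (x i : V)) := fun x => rfl
  have h := alternatingMap_apply_comp_eq_det_smul f w (u.restrict hW) (fun i => w i)
  rw [hf, hf] at h
  have hfun : (fun i => u (w i : V)) = fun i => ((u.restrict hW (w i) : W) : V) := by
    funext i; rw [LinearMap.coe_restrict_apply]
  rw [hfun]
  exact h

end Alternating

section Forms

variable {K V ι : Type*} [Field K] [AddCommGroup V] [Module K V]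

/-- **Eigenspaces of an isometry are orthogonal unless the eigenvalues are inverse to each other**: if
`B (T x) (T y) = B x y`, `T x = c x`, `T y = c' y` and `c c' ≠ 1` then `B x y = 0`. [folklore] -/
theorem form_eq_zero_of_eigenvalues (B : LinearMap.BilinForm K V) (T : Module.End K V)
    (hBT : ∀ x y, B (T x) (T y) = B x y) {c c' : K} (hcc : c * c' ≠ 1) {x y : V}
    (hx : x ∈ Module.End.eigenspace T c) (hy : y ∈ Module.End.eigenspace T c') : B x y = 0 := by
  rw [Module.End.mem_eigenspace_iff] at hx hy
  have h := hBT x y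
  rw [hx, hy, map_smul, LinearMap.map_smul₂, smul_eq_mul, smul_eq_mul] at h
  have h' : (c * c' - 1) * B x y = 0 := by rw [sub_mul, one_mul, mul_comm c c', mul_assoc, h, sub_self]
  rcases mul_eq_zero.1 h' with h1 | h1
  · exact absurd (sub_eq_zero.1 h1) hcc
  · exact h1

/-- **`V_c × V_{c⁻¹}` is perfect (left)**: for a non-degenerate `T`-invariant form and a `T`-eigenbasis `b`, an
element `x ∈ V_c` pairing to zero with `V_{c'}`, `c c' = 1`, is zero (it pairs to zero with every `b i`: those in
`V_{c'}` by hypothesis, the others by orthogonality). [folklore] -/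
theorem eq_zero_of_form_eigenspace_eq_zero (B : LinearMap.BilinForm K V) (hB : B.Nondegenerate)
    (T : Module.End K V) (hBT : ∀ x y, B (T x) (T y) = B x y) (b : Module.Basis ι K V) (lam : ι → K)
    (hb : ∀ i, b i ∈ Module.End.eigenspace T (lam i)) {c c' : K} (hcc : c * c' = 1) {x : V}
    (hx : x ∈ Module.End.eigenspace T c) (h0 : ∀ y ∈ Module.End.eigenspace T c', B x y = 0) : x = 0 := by
  refine hB.1 x fun y => ?_
  have hfun : B x = 0 := by
    refine b.ext fun i => ?_
    rw [LinearMap.zero_apply]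
    by_cases hi : lam i = c'
    · exact h0 _ (hi ▸ hb i)
    · refine form_eq_zero_of_eigenvalues B T hBT (c := c) (c' := lam i) ?_ hx (hb i)
      intro h
      apply hi
      have hc0 : c ≠ 0 := by rintro rfl; rw [zero_mul] at hcc; exact zero_ne_one hcc
      exact mul_left_cancel₀ hc0 (h.trans hcc.symm)
  rw [hfun, LinearMap.zero_apply]

/-- **`V_c × V_{c⁻¹}` is perfect (right)**: the same on the other side, for an ALTERNATING form
(`B y x = -B x y`). [folklore] -/
theorem eq_zero_of_form_eigenspace_eq_zero_right (B : LinearMap.BilinForm K V) (hB : B.Nondegenerate)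
    (hBalt : B.IsAlt) (T : Module.End K V) (hBT : ∀ x y, B (T x) (T y) = B x y) (b : Module.Basis ι K V)
    (lam : ι → K) (hb : ∀ i, b i ∈ Module.End.eigenspace T (lam i)) {c c' : K} (hcc : c * c' = 1) {y : V}
    (hy : y ∈ Module.End.eigenspace T c') (h0 : ∀ x ∈ Module.End.eigenspace T c, B x y = 0) : y = 0 := by
  refine eq_zero_of_form_eigenspace_eq_zero B hB T hBT b lam hb (c := c') (c' := c) (by rw [mul_comm]; exact hcc) hy
    fun x hx => ?_
  rw [← hBalt.neg_eq, h0 x hx, neg_zero]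

end Forms

end Summit.HodgeConjecture.HodgeConjecture.WeilTypeLadder
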